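import Literature.Computability.QuantumComplexity.GRLevelWord
import Literature.Computability.QuantumComplexity.CleanComputePlaced
import Literature.Computability.QuantumComplexity.ConjugateCtrlGate
import HarnessLib

/-!
# The Grover–Rudolph level step: compute the cosine word, rotate, uncompute

Topic `Literature/Computability/QuantumComplexity`; sequel of `GRLevelWord.lean` (the rotation gadget
controlled by a field of the label) and `CleanComputePlaced.lean` (a garbage-free classical block
placed on scattered data wires). Regev's sampler (Lemma 3.14 via Lemma 3.12: Grover–Rudolph state
preparation) rotates the level qubit `t` by an angle COMPUTED from the prefix: the level step is

  `C_rev · G · C`,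

`C` the placed clean block writing the `k`-bit cosine word `F(prefix)` on the field wires, `G` the
rotation word, `C_rev` the reversed block. By `implOn_conj_ctrlGate` (`ConjugateCtrlGate.lean`) the step
implements `ctrlGate t (z ↦ rotC (ã (F (prefix z))))` — the machine's level gate — on labels clean on
the kit and on the work window, with the gadget's error `grErr k`:

* `GRWord.fsW` — the field wires: the result wires of cells `0 … k−1`, code `symTrue`, of the block;
  `GRWord.workWires`, `GRWord.dataOf`; `clEval_update_of_forall_not_mem` (a program commutes with
  rewriting a wire it does not mention);
* `GRWord.MachOK` — the machine hypothesis: on `d ++ v` (`|d| = n₀` prefix bits) the machine outputs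
  the `k`-bit word `fbits d` within the time bound; `GRWord.ConjGeom` — geometry (window placement,
  the target and the kit wires off the block);
* **`GRWord.levelStep_implOn`** — the conjugated word implements
  `ctrlGate t (fun z => rotC (ã (bitsToNat (fbits (dataOf z)))))` on `kit.P ∩ cleanOn workWires` up to `grErr k`.

Everything here is proved; definitions have bodies; no named fact is introduced.

## References

* O. Regev, J. ACM 56 (2009), art. 34, Lemma 3.12 (proof), Lemma 3.14 (proof) [Regev2009].
* L. Grover, T. Rudolph, arXiv:quant-ph/0208112 (2002), eq. (5) [GroverRudolph2002].
* M. A. Nielsen, I. L. Chuang, *Quantum Computation and Quantum Information*, CUP 2010, §3.2.5, §4.3 [NielsenChuang2010].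
-/

noncomputable section

namespace Literature.Computability.QuantumComplexity

open Literature.Computability.Complexity (bitsToNat)
open _root_.Matrix Finset Cryptography RevSim RevClean GadgetKit GaussianCells Complexity.FinTM2Sim Turing

/-! ### A program commutes with rewriting a wire it does not mention -/

/-- **Frame rule**: if no operation mentions `t`, running the program commutes with rewriting `t`. [folklore] -/
theorem clEval_update_of_forall_not_mem {ι : Type*} [DecidableEq ι] (ops : List (ClOp ι)) {t : ι}
    (ht : ∀ op ∈ ops, t ∉ wiresOf op) (w : ι → Bool) (b : Bool) :
    clEval ops (Function.update w t b) = Function.update (clEval ops w) t b := by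
  funext i
  by_cases hi : i = t
  · subst hi
    rw [Function.update_self, clEval_apply_of_forall_target_ne _ _ (fun op hop h => ht op hop ((mem_wiresOf _ _).2 (Or.inl h.symm))),
      Function.update_self]
  · rw [Function.update_of_ne hi]
    exact clEval_agree (· ≠ t) ops (fun op hop i hi' h => ht op hop (h ▸ hi')) (fun i' hi' => Function.update_of_ne hi' _ _) i hi

namespace GRWord

variable {N : ℕ}

section Conj

variable {kit : GadgetKit N} (hk : kit.OK) (e : ℕ) (M : TM2ComputableAux Bool Bool) (n₀ : ℕ) (v : List Bool) (dpos : ℕ → ℕ) (base : ℕ)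

/-- **The field wires**: the result wire of cell `b`, code `symTrue`, of the block, inside the work window. [folklore] -/
def fsW (b : ℕ) : Fin N := finOf N kit.hN (base + (resW e M (n₀ + v.length) b (CWrap.symTrue M) - n₀))

/-- **The work-window wires.** [folklore] -/
def workWires : List (Fin N) := (List.range (CleanPlaced.top e M n₀ v base - base)).map fun w => finOf N kit.hN (base + w)

/-- **The prefix word read off a label.** [folklore] -/
def dataOf (z : QReg N) : List Bool := List.ofFn fun i : Fin n₀ => z (finOf N kit.hN (dpos i))

omit hk in
/-- The prefix word has length `n₀`. [folklore] -/
theorem length_dataOf (z : QReg N) : (dataOf (kit := kit) n₀ dpos z).length = n₀ := List.length_ofFn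

/-- **The machine hypothesis**: on an admissible data word (`Dok`: e.g. its parameter part holds the
instance parameters) followed by the constant suffix the machine outputs the `k`-bit field word within the
time bound. [cite: Regev2009, Lemma 3.12 (proof)] -/
structure MachOK (kit : GadgetKit N) (e : ℕ) (M : TM2ComputableAux Bool Bool) (n₀ : ℕ) (v : List Bool) (Dok : List Bool → Prop)
    (fbits : List Bool → List Bool) : Prop where
  /-- the output -/
  out : ∀ d : List Bool, d.length = n₀ → Dok d → M.OutputsWithin (d ++ v) (fbits d) (Tn e (d.length + v.length))
  /-- of length `k` -/
  len : ∀ d : List Bool, d.length = n₀ → Dok d → (fbits d).length = kit.k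

/-- **Geometry of the conjugated step.** [folklore] -/
structure ConjGeom (kit : GadgetKit N) (t : Fin N) (e : ℕ) (M : TM2ComputableAux Bool Bool) (n₀ : ℕ) (v : List Bool) (dpos : ℕ → ℕ)
    (base : ℕ) : Prop where
  /-- the placement geometry -/
  geom : CleanPlaced.GeomOK N e M n₀ v dpos base
  /-- the target is not a prefix wire and lies below the window -/
  t_dpos : ∀ i, i < n₀ → (t : ℕ) ≠ dpos i
  t_lt : (t : ℕ) < base
  /-- the kit's clean wires are off the window and are not prefix wires -/
  kit_off : ∀ a ∈ kit.cr :: kit.as ++ kit.region ++ kit.hs, ((a : ℕ) < base ∨ CleanPlaced.top e M n₀ v base ≤ (a : ℕ)) ∧ ∀ i, i < n₀ → (a : ℕ) ≠ dpos i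
  /-- the field cells fit in the read-out zone -/
  k_le : kit.k ≤ JJ e M (n₀ + v.length)

variable {e M n₀ v dpos base} {t : Fin N} {Dok : List Bool → Prop} {fbits : List Bool → List Bool}
variable (hM : MachOK kit e M n₀ v Dok fbits) (hG : ConjGeom kit t e M n₀ v dpos base)

include hG in
/-- The field wires are in the work window. [folklore] -/
theorem fsW_window {b : ℕ} (hb : b < kit.k) :
    base ≤ base + (resW e M (n₀ + v.length) b (CWrap.symTrue M) - n₀) ∧
      base + (resW e M (n₀ + v.length) b (CWrap.symTrue M) - n₀) < CleanPlaced.top e M n₀ v base := by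
  refine ⟨Nat.le_add_right _ _, ?_⟩
  have h1 := resW_lt_width (e := e) (M := M) (n := n₀ + v.length) (lt_of_lt_of_le hb hG.k_le) (CWrap.symTrue M)
  have h2 := NN_le_resW (e := e) (M := M) (n₀ + v.length) b (CWrap.symTrue M)
  have h3 := le_NN (e := e) (M := M) (n₀ + v.length)
  unfold CleanPlaced.top; omega

include hG in
/-- **The field wires as an embedding.** [folklore] -/
theorem fsW_injective : Function.Injective fun b : Fin kit.k => fsW (kit := kit) e M n₀ v base b := by
  intro b b' h
  have htop := hG.geom.top_le
  have hb := fsW_window hG b.2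
  have hb' := fsW_window hG b'.2
  have hv := congrArg Fin.val h
  simp only [fsW] at hv
  rw [val_finOf_of_lt kit.hN (hb.2.trans_le htop), val_finOf_of_lt kit.hN (hb'.2.trans_le htop)] at hv
  have h2 := NN_le_resW (e := e) (M := M) (n₀ + v.length) b (CWrap.symTrue M)
  have h2' := NN_le_resW (e := e) (M := M) (n₀ + v.length) b' (CWrap.symTrue M)
  have h3 := le_NN (e := e) (M := M) (n₀ + v.length)
  have : resW e M (n₀ + v.length) b (CWrap.symTrue M) = resW e M (n₀ + v.length) b' (CWrap.symTrue M) := by omega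
  exact Fin.ext (resW_inj this).1

/-- The field wires as an embedding. [folklore] -/
def fsEmb (hG : ConjGeom kit t e M n₀ v dpos base) : Fin kit.k ↪ Fin N := ⟨fun b => fsW (kit := kit) e M n₀ v base b, fsW_injective hG⟩

include hM hG in
/-- **The field after the block is the machine's word.** For `z` clean on the work window,
`fieldOf fs (κ₁ z) = bitsToNat (fbits (dataOf z))`. [cite: Regev2009, Lemma 3.12 (proof)] -/
theorem fieldOf_clEval (z : QReg N) (hz : z ∈ cleanOn (workWires (kit := kit) e M n₀ v base)) (hzD : Dok (dataOf (kit := kit) n₀ dpos z)) :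
    fieldOf (fsEmb hG) (clEval (CleanPlaced.placedOps kit.hN e M n₀ v dpos base) z) = bitsToNat (fbits (dataOf (kit := kit) n₀ dpos z)) := by
  set d := dataOf (kit := kit) n₀ dpos z with hd
  have hdl : d.length = n₀ := length_dataOf n₀ dpos z
  have hout := hM.out d hdl hzD
  have hlen := hM.len d hdl hzD
  have htop := hG.geom.top_le
  have hzw : ∀ w, base + w < CleanPlaced.top e M n₀ v base → z (finOf N kit.hN (base + w)) = false := fun w hw =>
    hz _ (List.mem_map.2 ⟨w, List.mem_range.2 (by omega), rfl⟩)
  have hzd : ∀ i (hi : i < n₀), z (finOf N kit.hN (dpos i)) = d.getD i false := by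
    intro i hi
    rw [hd, dataOf, List.getD_eq_getElem?_getD, List.getElem?_ofFn]
    simp [hi]
  obtain ⟨-, hsem⟩ := CleanPlaced.clEval_placedOps hG.geom d (fbits d) hdl hout z hzd hzw
  unfold fieldOf
  have hbits : (List.ofFn (clEval (CleanPlaced.placedOps kit.hN e M n₀ v dpos base) z ∘ ⇑(fsEmb hG))) =
      List.ofFn fun b : Fin kit.k => (fbits d)[(b : ℕ)]'(by rw [hlen]; exact b.2) := by
    refine List.ofFn_inj.2 (funext fun b => ?_)
    have hw := fsW_window hG b.2
    show clEval _ z (finOf N kit.hN (base + (resW e M (n₀ + v.length) b (CWrap.symTrue M) - n₀))) = _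
    rw [hsem _ hw.2]
    have h2 := NN_le_resW (e := e) (M := M) (n₀ + v.length) b (CWrap.symTrue M)
    have h3 := le_NN (e := e) (M := M) (n₀ + v.length)
    rw [show n₀ + (resW e M (n₀ + v.length) (b : ℕ) (CWrap.symTrue M) - n₀) = resW e M (n₀ + v.length) b (CWrap.symTrue M) by omega,
      readOut_resW (lt_of_lt_of_le b.2 hG.k_le)]
    have hdu : (d ++ v).length = n₀ + v.length := by rw [List.length_append, hdl]
    have hout' : M.OutputsWithin (d ++ v) (fbits d) (Tn e (n₀ + v.length)) := by rwa [hdl] at hout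
    exact CWrap.outBit_symTrue_eq hdu hout' (by rw [hlen]; exact b.2)
  rw [hbits]
  congr 1
  have e1 : (List.ofFn fun b : Fin kit.k => (fbits d)[(b : ℕ)]'(by rw [hlen]; exact b.2)) =
      List.ofFn fun b : Fin (fbits d).length => (fbits d)[(b : ℕ)] := by
    refine List.ext_getElem (by simp [hlen]) fun i h₁ h₂ => ?_
    simp
  rw [e1, List.ofFn_getElem]

include hG in
/-- The target is not a wire of the placed block. [folklore] -/
theorem t_not_mem_wires : ∀ op ∈ CleanPlaced.placedOps kit.hN e M n₀ v dpos base, t ∉ wiresOf op := by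
  intro op hop hx
  rcases CleanPlaced.mem_wires_placedOps hG.geom hop hx with ⟨i, hi, h⟩ | ⟨h1, -⟩
  · exact hG.t_dpos i hi h
  · exact absurd hG.t_lt (not_lt.2 h1)

include hM hG hk in
/-- **The level step.** On any condition `P ⊆ kit.P ∩ cleanOn workWires` on which the
machine's field word encodes the block `U z` (`rotC (ã (F (prefix z))) = U z` for `z ∈ P`), the conjugated
word `C_rev · G · C` implements `ctrlGate t U` on `P` up to `grErr k`.
[cite: Regev2009, Lemma 3.12 (proof)] [cite: GroverRudolph2002, eq. (5)] [cite: NielsenChuang2010, §3.2.5] -/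
theorem levelStep_implOn (hW : WiresOK kit t (fsEmb hG)) (hP : ProgOK kit) {P : Set (QReg N)}
    (hPsub : P ⊆ kit.P ∩ cleanOn (workWires (kit := kit) e M n₀ v base)) (hD : ∀ z ∈ P, Dok (dataOf (kit := kit) n₀ dpos z))
    {U : QReg N → Matrix (QReg 1) (QReg 1) ℂ}
    (hU : ∀ z ∈ P, rotC (SLP.aTil kit.k (bitsToNat (fbits (dataOf (kit := kit) n₀ dpos z)))) = U z) :
    ImplOn P
      ((CleanPlaced.circuitRev hG.geom (hN := kit.hN)).toMatrix 0 * (grWord hk hW hP).toMatrix 0 *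
        (CleanPlaced.circuit hG.geom (hN := kit.hN)).toMatrix 0)
      (ctrlGate t U) (grErr kit.k) := by
  set ops := CleanPlaced.placedOps kit.hN e M n₀ v dpos base with hops
  have hwf := CleanPlaced.placedOps_wf hG.geom (hN := kit.hN)
  have hgood := grWord_good hk hW hP
  have htop := hG.geom.top_le
  refine implOn_conj_ctrlGate (CleanPlaced.isBasisMap_circuit hG.geom) (CleanPlaced.isBasisMap_circuitRev hG.geom)
    (isContraction_of_mem_unitaryGroup (CleanPlaced.circuit_mem_unitaryGroup hG.geom).1)
    (isContraction_of_mem_unitaryGroup (CleanPlaced.circuit_mem_unitaryGroup hG.geom).2) t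
    (by unfold grErr; positivity) hgood.implOn ?_ ?_ ?_ ?_
  · -- `κ₁` keeps the kit's wires clean
    intro z hz
    obtain ⟨hzP, hzw⟩ := hPsub hz
    have hzw' : ∀ w, base + w < CleanPlaced.top e M n₀ v base → z (finOf N kit.hN (base + w)) = false := fun w hw =>
      hzw _ (List.mem_map.2 ⟨w, List.mem_range.2 (by omega), rfl⟩)
    set d := dataOf (kit := kit) n₀ dpos z with hd
    have hdl : d.length = n₀ := length_dataOf n₀ dpos z
    have hzd : ∀ i (hi : i < n₀), z (finOf N kit.hN (dpos i)) = d.getD i false := by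
      intro i hi; rw [hd, dataOf, List.getD_eq_getElem?_getD, List.getElem?_ofFn]; simp [hi]
    obtain ⟨hoff, -⟩ := CleanPlaced.clEval_placedOps hG.geom d (fbits d) hdl (hM.out d hdl (hD z hz)) z hzd hzw'
    have hkeep : ∀ a ∈ kit.cr :: kit.as ++ kit.region ++ kit.hs, clEval ops z a = z a := fun a ha => hoff a (hG.kit_off a ha).1
    constructor
    · intro a ha
      rw [hkeep a (List.mem_append_left _ ha)]; exact hzP.1 a ha
    · intro a ha
      rw [hkeep a (List.mem_append_right _ ha)]; exact hzP.2 a ha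
  · -- the field after the block
    intro z hz
    obtain ⟨-, hzw⟩ := hPsub hz
    show grBlock (fsEmb hG) (clEval ops z) = U z
    rw [grBlock, fieldOf_clEval hM hG z hzw (hD z hz), hU z hz]
  · -- the target is untouched
    intro z _
    exact clEval_apply_of_forall_target_ne _ _ fun op hop h => t_not_mem_wires hG op hop ((mem_wiresOf _ _).2 (Or.inl h.symm))
  · -- uncomputing after rewriting the target
    intro z _ b
    show clEval ops.reverse (Function.update (clEval ops z) t b) = Function.update z t b
    rw [clEval_update_of_forall_not_mem _ (fun op hop => t_not_mem_wires hG op (List.mem_reverse.1 hop)), clEval_reverse_clEval _ hwf]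

end Conj

end GRWord

end Literature.Computability.QuantumComplexity

end
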